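import Literature.Geometry.Conformal.MoebiusSphere
import Mathlib.Geometry.Euclidean.Inversion.Basic
import Mathlib.LinearAlgebra.FiniteDimensional.Basic
import HarnessLib

/-!
# Möbius transformations of `Sⁿ` and similarities/inversions of `ℝⁿ` under stereographic projection (proved)

Topic `Literature/Geometry/Conformal`. Infrastructure for Kuiper's theorem
(`Literature/Geometry/Riemannian/KuiperProofs.lean`, step 1): under the inverse stereographic
projection `σ⁻¹ : (ℝ ∙ v)ᗮ → S` of Mathlib (`stereoInvFun`, pole `v`, `‖v‖ = 1`; note Mathlib's
convention `σ⁻¹(w) = (‖w‖² + 4)⁻¹ (4 w + (‖w‖² − 4) v)`, under which the equator corresponds to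
the sphere of radius `2`), the maps of the hyperplane `K = (ℝ ∙ v)ᗮ` occurring in
Liouville's theorem — similarities `w ↦ c • A w + b` (`c > 0`, `A` a linear isometry) and
inversions in spheres — are restrictions of Möbius transformations of the sphere `S`, i.e. of the action of
the orthochronous Lorentz group `Literature.Conformal.lorentzGroup F` (`MoebiusSphere.lean`).

Everything here is PROVED, by exhibiting the Lorentz matrices: for a linear isometry `B` of `F`
the map `(t, x) ↦ (t, B x)` (giving isometries of `K` fixing the pole, and the reflection in `K`,
which corresponds to the inversion of `K` in the sphere of radius `2`), the boosts
`(t, x) ↦ (p t + q ⟪v,x⟫, x + (q t + (p−1)⟪v,x⟫) v)`, `p² − q² = 1` (scalings by `p + q`), and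
the parabolic maps `translLorentz` (translations of `K`).

## Main results

* `Literature.Geometry.Conformal.lorentzGroup.ofLinearMap`: a Lorentz-form-preserving, future-preserving linear
  endomorphism of `ℝ × F` (`F` finite-dimensional) is in the Lorentz group.
* `Literature.Geometry.Conformal.exists_smul_stereoInvFun_eq_similarity`: for `c > 0`, `A : K →ₗᵢ[ℝ] K`,
  `b : K` there is `γ` in the Lorentz group with `γ • σ⁻¹(w) = σ⁻¹(c • A w + b)` for all `w`.
* `Literature.Geometry.Conformal.exists_smul_stereoInvFun_eq_inversion`: for `x₀ : K`, `r > 0` there is `γ`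
  with `γ • σ⁻¹(w) = σ⁻¹(inversion x₀ r w)` for all `w ≠ x₀` (`EuclideanGeometry.inversion`).
* `Literature.Geometry.Conformal.exists_moebiusMaps_similarity`, `Literature.Geometry.Conformal.exists_moebiusMaps_inversion`:
  the same for Mathlib's chart `stereographic' n V` of the sphere of `EuclideanSpace`-dimension
  `n + 1` and the set `moebiusMaps F` of Möbius self-maps of the sphere.

## Related declarations in the tree

* `Literature.StatMech.moebiusGroup d`, `Literature.Probability.LatticeModels.IsMoebius`
  (`Literature/Probability/LatticeModels/ConformalCovariance.lean`): the Möbius group of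
  `ℝ^d ∪ {∞}` in the one-point-compactification model, generated by the similarities and the
  unit inversion, without manifold structure. The Lorentz/sphere model of `MoebiusSphere.lean`
  is used for Kuiper's theorem because `Metric.sphere 0 1` carries Mathlib's analytic manifold
  structure (stereographic charts), in which the developing map must be a local diffeomorphism;
  the present file is the bridge between the two descriptions: the generators of
  `moebiusGroup` correspond, in stereographic coordinates, to elements of
  `Literature.Conformal.lorentzGroup F` acting on the sphere.
* `Literature.Conformal.lorentzGroup F` is the *orthochronous* Lorentz group `O⁺(n+1, 1)` (it
  preserves the future light cone); compare `lorentzGroup` / `orthochronousLorentzGroup` in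
  `Literature/MathematicalPhysics/QuantumLattice/MinkowskiGeometry.lean` (Minkowski space-time,
  continuous linear equivalences), which are not used here.

## References

* R. Benedetti, C. Petronio, *Lectures on Hyperbolic Geometry*, Springer 1992, §A.3–A.4
  (conformal geometry of `Sⁿ`, the groups `Conf(Sⁿ)` and `O(n+1,1)`), Thm. A.3.7 (Liouville).
* N. H. Kuiper, *On conformally-flat spaces in the large*, Ann. of Math. (2) 50 (1949) 916–924.
-/

noncomputable section

open Metric Module Function Set Filter
open scoped Manifold ContDiff Topology RealInnerProductSpace

namespace Literature.Geometry.Conformal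

variable {F : Type*} [NormedAddCommGroup F] [InnerProductSpace ℝ F]

/-! ### General constructions -/

section General

/-- Polarisation: a linear map preserving the Lorentz quadratic form preserves the Lorentz
bilinear form. [folklore] -/
theorem lorentzForm_map_map_of_self (L : (ℝ × F) →ₗ[ℝ] (ℝ × F))
    (h : ∀ u, lorentzForm (L u) (L u) = lorentzForm u u) (u w : ℝ × F) :
    lorentzForm (L u) (L w) = lorentzForm u w := by
  have h1 := h (u + w)
  rw [map_add, lorentzForm_add_left, lorentzForm_comm (L u) (L u + L w),
    lorentzForm_comm (L w) (L u + L w), lorentzForm_add_left, lorentzForm_add_left, h u, h w,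
    lorentzForm_add_left, lorentzForm_comm u (u + w), lorentzForm_comm w (u + w),
    lorentzForm_add_left, lorentzForm_add_left, lorentzForm_comm (L w) (L u),
    lorentzForm_comm w u] at h1
  linarith

/-- A linear map preserving the Lorentz form is injective (the form is nondegenerate).
[folklore] -/
theorem injective_of_lorentzForm_map_map (L : (ℝ × F) →ₗ[ℝ] (ℝ × F))
    (h : ∀ u w, lorentzForm (L u) (L w) = lorentzForm u w) : Injective L := by
  refine (injective_iff_map_eq_zero L).mpr fun u hu => ?_
  have h0 : ∀ w, lorentzForm u w = 0 := fun w => by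
    rw [← h u w, hu]
    simp [lorentzForm]
  have h1 : u.1 = 0 := by
    have := h0 ((1 : ℝ), (0 : F))
    simpa [lorentzForm] using this
  have h2 : u.2 = 0 := by
    have := h0 ((0 : ℝ), u.2)
    simpa [lorentzForm] using this
  exact Prod.ext h1 h2

variable [FiniteDimensional ℝ F]

/-- **Constructor for elements of the Lorentz group** (`F` finite-dimensional): a linear
endomorphism of `ℝ × F` preserving the Lorentz quadratic form and mapping the vectors `(1, y)`,
`‖y‖ = 1`, into the future is (bijective, and) an element of `lorentzGroup F`. [folklore] -/
def lorentzGroup.ofLinearMap (L : (ℝ × F) →ₗ[ℝ] (ℝ × F))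
    (h : ∀ u, lorentzForm (L u) (L u) = lorentzForm u u)
    (h' : ∀ y : F, ‖y‖ = 1 → 0 < (L ((1 : ℝ), y)).1) : lorentzGroup F :=
  ⟨LinearEquiv.ofInjectiveEndo L
      (injective_of_lorentzForm_map_map L (lorentzForm_map_map_of_self L h)),
    ⟨fun u w => lorentzForm_map_map_of_self L h u w, h'⟩⟩

/-- `lorentzGroup.ofLinearMap L` acts as `L`. [folklore] -/
@[simp]
theorem lorentzGroup.coe_ofLinearMap_apply (L : (ℝ × F) →ₗ[ℝ] (ℝ × F))
    (h : ∀ u, lorentzForm (L u) (L u) = lorentzForm u u)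
    (h' : ∀ y : F, ‖y‖ = 1 → 0 < (L ((1 : ℝ), y)).1) (u : ℝ × F) :
    ((lorentzGroup.ofLinearMap L h h' : lorentzGroup F) : (ℝ × F) ≃ₗ[ℝ] (ℝ × F)) u = L u :=
  rfl

omit [FiniteDimensional ℝ F] in
/-- **Criterion for the Möbius action**: if `A (1, y)` is a multiple of `(1, z)` then
`A • y = z`. [folklore] -/
theorem moebius_eq_of_apply_eq {A : lorentzGroup F} {y z : sphere (0 : F) 1} {μ : ℝ}
    (h : (A : (ℝ × F) ≃ₗ[ℝ] (ℝ × F)) ((1 : ℝ), (y : F)) = μ • ((1 : ℝ), (z : F))) :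
    A • y = z := by
  have hμ : ((A : (ℝ × F) ≃ₗ[ℝ] (ℝ × F)) ((1 : ℝ), (y : F))).1 = μ := by
    rw [h, Prod.smul_fst, smul_eq_mul, mul_one]
  have hμ0 : μ ≠ 0 := hμ ▸ (fst_apply_pos A (norm_eq_of_mem_sphere y)).ne'
  ext1
  rw [smul_def, coe_moebius, hμ, h, Prod.smul_snd, smul_smul, inv_mul_cancel₀ hμ0, one_smul]

end General

/-! ### Stereographic coordinates: the light-cone vector of `σ⁻¹(w)` -/

section Stereo

variable {v : F}

/-- The (unnormalised) light-cone vector `X(w) = (‖w‖² + 4, 4 w + (‖w‖² − 4) v)` of the point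
`σ⁻¹(w)` of the sphere, `w ∈ (ℝ ∙ v)ᗮ`. [folklore] -/
def coneVec (v : F) (w : F) : ℝ × F :=
  ((‖w‖ ^ 2 + 4 : ℝ), (4 : ℝ) • w + (‖w‖ ^ 2 - 4) • v)

/-- Components of `coneVec`. [folklore] -/
@[simp] theorem coneVec_fst (v w : F) : (coneVec v w).1 = ‖w‖ ^ 2 + 4 := rfl

/-- Components of `coneVec`. [folklore] -/
@[simp] theorem coneVec_snd (v w : F) : (coneVec v w).2 = (4 : ℝ) • w + (‖w‖ ^ 2 - 4) • v := rfl

/-- `(1, σ⁻¹(w)) = (‖w‖² + 4)⁻¹ • X(w)`. [folklore] -/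
theorem one_stereoInvFun_eq (hv : ‖v‖ = 1) (w : (ℝ ∙ v)ᗮ) :
    (((1 : ℝ), (stereoInvFun hv w : F)) : ℝ × F) = (‖(w : F)‖ ^ 2 + 4)⁻¹ • coneVec v (w : F) := by
  have hc : (‖(w : F)‖ ^ 2 + 4 : ℝ) ≠ 0 := by positivity
  ext
  · simp only [Prod.smul_fst, coneVec_fst, smul_eq_mul, inv_mul_cancel₀ hc]
  · rfl

/-- **Action criterion in stereographic coordinates**: if `A X(w) = ν • X(w')` then
`A • σ⁻¹(w) = σ⁻¹(w')`. [folklore] -/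
theorem moebius_stereoInvFun_eq (hv : ‖v‖ = 1) {A : lorentzGroup F} {w w' : (ℝ ∙ v)ᗮ} {ν : ℝ}
    (h : (A : (ℝ × F) ≃ₗ[ℝ] (ℝ × F)) (coneVec v (w : F)) = ν • coneVec v (w' : F)) :
    A • stereoInvFun hv w = stereoInvFun hv w' := by
  refine moebius_eq_of_apply_eq
    (μ := (‖(w : F)‖ ^ 2 + 4)⁻¹ * ν * (‖(w' : F)‖ ^ 2 + 4)) ?_
  have hc' : (‖(w' : F)‖ ^ 2 + 4 : ℝ) ≠ 0 := by positivity
  rw [one_stereoInvFun_eq hv w, LinearEquiv.map_smul, h, one_stereoInvFun_eq hv w', smul_smul,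
    smul_smul, mul_assoc, mul_inv_cancel₀ hc', mul_one]

end Stereo

/-! ### Isometries of `F` as Lorentz transformations -/

section Isometry

variable [FiniteDimensional ℝ F]

/-- The Lorentz transformation `(t, x) ↦ (t, B x)` of a linear isometry `B` of `F`. [folklore] -/
def isometryLorentz (B : F →ₗᵢ[ℝ] F) : lorentzGroup F :=
  lorentzGroup.ofLinearMap (LinearMap.prodMap LinearMap.id B.toLinearMap)
    (fun u => by simp [lorentzForm])
    (fun y hy => by simp)

/-- `isometryLorentz B` acts as `(t, x) ↦ (t, B x)`. [folklore] -/
@[simp]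
theorem isometryLorentz_apply (B : F →ₗᵢ[ℝ] F) (u : ℝ × F) :
    ((isometryLorentz B : lorentzGroup F) : (ℝ × F) ≃ₗ[ℝ] (ℝ × F)) u = (u.1, B u.2) :=
  rfl

/-- The Möbius action of `isometryLorentz B` on the sphere is `B` itself. [folklore] -/
theorem coe_isometryLorentz_smul (B : F →ₗᵢ[ℝ] F) (y : sphere (0 : F) 1) :
    ((isometryLorentz B • y : sphere (0 : F) 1) : F) = B y := by
  rw [smul_def, coe_moebius, isometryLorentz_apply]
  simp

end Isometry

/-! ### The reflection in the hyperplane `K = (ℝ ∙ v)ᗮ` and the inversion of `K` in the sphere of radius `2` -/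

section Reflection

variable {v : F}

/-- The reflection of `F` in the hyperplane `K = (ℝ ∙ v)ᗮ` (`‖v‖ = 1`) — Mathlib's
`Submodule.reflection` of the subspace `(ℝ ∙ v)ᗮ` — is `x ↦ x − 2 ⟪v, x⟫ v`. [folklore] -/
theorem reflection_orthogonal_apply_eq (hv : ‖v‖ = 1) (x : F) :
    (ℝ ∙ v)ᗮ.reflection x = x - (2 * ⟪v, x⟫) • v := by
  rw [Submodule.reflection_orthogonal_apply, Submodule.reflection_apply,
    Submodule.starProjection_unit_singleton ℝ hv, two_smul, mul_smul, two_smul]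
  abel

/-- The reflection in `K` maps the cone vector `X(w)` of `w ≠ 0` to `(‖w‖²/4) • X(w')`, where
`w' = (4/‖w‖²) w` is the inverse of `w` in the sphere of radius `2` of `K`. [folklore] -/
theorem reflection_coneVec (hv : ‖v‖ = 1) {w : F} (hw : ⟪v, w⟫ = 0) (hw0 : w ≠ 0) :
    (((coneVec v w).1, (ℝ ∙ v)ᗮ.reflection (coneVec v w).2) : ℝ × F) =
      (‖w‖ ^ 2 / 4) • coneVec v ((4 / ‖w‖ ^ 2) • w) := by
  have hn : ‖w‖ ≠ 0 := norm_ne_zero_iff.mpr hw0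
  have hn2 : ‖w‖ ^ 2 ≠ 0 := pow_ne_zero 2 hn
  have hnorm : ‖(4 / ‖w‖ ^ 2) • w‖ ^ 2 = 16 / ‖w‖ ^ 2 := by
    rw [norm_smul, Real.norm_eq_abs, abs_of_pos (by positivity), mul_pow]
    field_simp
    ring
  ext
  · simp only [coneVec_fst, Prod.smul_fst, smul_eq_mul, hnorm]
    field_simp
    ring
  · simp only [coneVec_snd, Prod.smul_snd, reflection_orthogonal_apply_eq hv, hnorm,
      inner_add_right, inner_smul_right, hw, real_inner_self_eq_norm_sq, hv, smul_add, smul_smul]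
    have e1 : ‖w‖ ^ 2 / 4 * (4 * (4 / ‖w‖ ^ 2)) = 4 := by field_simp
    have e2 : ‖w‖ ^ 2 / 4 * (16 / ‖w‖ ^ 2 - 4) = -(‖w‖ ^ 2 - 4) := by field_simp; ring
    rw [e1, e2]
    simp only [mul_zero, one_pow, mul_one, zero_add]
    rw [sub_eq_iff_eq_add, neg_smul]
    have : (2 * (‖w‖ ^ 2 - 4)) • v = (‖w‖ ^ 2 - 4) • v + (‖w‖ ^ 2 - 4) • v := by
      rw [two_mul, add_smul]
    rw [this]
    abel

variable [FiniteDimensional ℝ F]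

/-- **The inversion of `K` in the sphere of radius `2` is a Möbius transformation**: the
reflection of the sphere in the hyperplane `K` satisfies `R • σ⁻¹(w) = σ⁻¹((4/‖w‖²) w)` for
`w ≠ 0`. [folklore] -/
theorem reflection_smul_stereoInvFun (hv : ‖v‖ = 1) (w : (ℝ ∙ v)ᗮ) (hw0 : w ≠ 0) :
    isometryLorentz ((ℝ ∙ v)ᗮ.reflection.toLinearIsometry) • stereoInvFun hv w =
      stereoInvFun hv ((4 / ‖(w : F)‖ ^ 2) • w) := by
  refine moebius_stereoInvFun_eq hv (ν := ‖(w : F)‖ ^ 2 / 4) ?_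
  rw [isometryLorentz_apply, Submodule.coe_smul]
  exact reflection_coneVec hv (Submodule.mem_orthogonal_singleton_iff_inner_right.mp w.2)
    (fun h => hw0 (Subtype.ext h))

end Reflection

/-! ### Isometries of `K` fixing the origin -/

section ExtendIsometry

variable {v : F}

/-- The orthogonal projection of `F` onto `K = (ℝ ∙ v)ᗮ` (`‖v‖ = 1`; Mathlib's
`Submodule.orthogonalProjectionOnto`) is `x ↦ x − ⟪v, x⟫ v`. [folklore] -/
theorem coe_orthogonalProjectionOnto_orthogonal_eq (hv : ‖v‖ = 1) (x : F) :
    ((ℝ ∙ v)ᗮ.orthogonalProjectionOnto x : F) = x - ⟪v, x⟫ • v := by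
  rw [Submodule.coe_orthogonalProjectionOnto_apply, Submodule.starProjection_orthogonal_val,
    Submodule.starProjection_unit_singleton ℝ hv]

/-- `x = P_K x + ⟪v,x⟫ v` for the orthogonal projection `P_K` onto `K = (ℝ ∙ v)ᗮ`. [folklore] -/
theorem coe_orthogonalProjectionOnto_add_smul (hv : ‖v‖ = 1) (x : F) :
    ((ℝ ∙ v)ᗮ.orthogonalProjectionOnto x : F) + ⟪v, x⟫ • v = x := by
  rw [coe_orthogonalProjectionOnto_orthogonal_eq hv, sub_add_cancel]

/-- `‖k + s v‖² = ‖k‖² + s²` for `k ∈ K`. [folklore] -/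
theorem norm_coe_add_smul_sq (hv : ‖v‖ = 1) (k : (ℝ ∙ v)ᗮ) (s : ℝ) :
    ‖(k : F) + s • v‖ ^ 2 = ‖(k : F)‖ ^ 2 + s ^ 2 := by
  rw [norm_add_sq_real, real_inner_smul_right, real_inner_comm,
    Submodule.mem_orthogonal_singleton_iff_inner_right.mp k.2, norm_smul, hv, Real.norm_eq_abs,
    mul_one, sq_abs]
  ring

/-- **Extension of a linear isometry `B` of `K` to `F`** fixing the pole: `x ↦ B(P_K x) +
⟪v,x⟫ v`, `P_K` the orthogonal projection onto `K = (ℝ ∙ v)ᗮ`. [folklore] -/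
def extendIsometry (hv : ‖v‖ = 1) (B : (ℝ ∙ v)ᗮ →ₗᵢ[ℝ] (ℝ ∙ v)ᗮ) : F →ₗᵢ[ℝ] F where
  toLinearMap :=
    (ℝ ∙ v)ᗮ.subtype ∘ₗ B.toLinearMap ∘ₗ ((ℝ ∙ v)ᗮ.orthogonalProjectionOnto).toLinearMap +
      (LinearMap.toSpanSingleton ℝ F v) ∘ₗ (innerₛₗ ℝ v)
  norm_map' x := by
    change ‖(B ((ℝ ∙ v)ᗮ.orthogonalProjectionOnto x) : F) + ⟪v, x⟫ • v‖ = ‖x‖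
    rw [← sq_eq_sq₀ (norm_nonneg _) (norm_nonneg _), norm_coe_add_smul_sq hv,
      Submodule.norm_coe, B.norm_map, Submodule.coe_norm, ← norm_coe_add_smul_sq hv,
      coe_orthogonalProjectionOnto_add_smul hv]

/-- The formula for `extendIsometry`. [folklore] -/
theorem extendIsometry_apply (hv : ‖v‖ = 1) (B : (ℝ ∙ v)ᗮ →ₗᵢ[ℝ] (ℝ ∙ v)ᗮ) (x : F) :
    extendIsometry hv B x = (B ((ℝ ∙ v)ᗮ.orthogonalProjectionOnto x) : F) + ⟪v, x⟫ • v :=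
  rfl

/-- On `K`, `extendIsometry hv B` is `B`. [folklore] -/
theorem extendIsometry_coe (hv : ‖v‖ = 1) (B : (ℝ ∙ v)ᗮ →ₗᵢ[ℝ] (ℝ ∙ v)ᗮ) (w : (ℝ ∙ v)ᗮ) :
    extendIsometry hv B (w : F) = B w := by
  rw [extendIsometry_apply, Submodule.orthogonalProjectionOnto_mem_subspace_eq_self,
    Submodule.mem_orthogonal_singleton_iff_inner_right.mp w.2, zero_smul, add_zero]

/-- `extendIsometry hv B` fixes the pole `v`. [folklore] -/
theorem extendIsometry_pole (hv : ‖v‖ = 1) (B : (ℝ ∙ v)ᗮ →ₗᵢ[ℝ] (ℝ ∙ v)ᗮ) :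
    extendIsometry hv B v = v := by
  have h0 : (ℝ ∙ v)ᗮ.orthogonalProjectionOnto v = 0 :=
    Submodule.orthogonalProjectionOnto_orthogonal_apply_eq_zero
      (Submodule.mem_span_singleton_self v)
  rw [extendIsometry_apply, h0, map_zero, Submodule.coe_zero, zero_add,
    real_inner_self_eq_norm_sq, hv, one_pow, one_smul]

variable [FiniteDimensional ℝ F]

/-- **Linear isometries of `K` are Möbius transformations**: `B̃ • σ⁻¹(w) = σ⁻¹(B w)`.
[folklore] -/
theorem extendIsometry_smul_stereoInvFun (hv : ‖v‖ = 1) (B : (ℝ ∙ v)ᗮ →ₗᵢ[ℝ] (ℝ ∙ v)ᗮ)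
    (w : (ℝ ∙ v)ᗮ) :
    isometryLorentz (extendIsometry hv B) • stereoInvFun hv w = stereoInvFun hv (B w) := by
  refine moebius_stereoInvFun_eq hv (ν := 1) ?_
  rw [isometryLorentz_apply, one_smul]
  ext
  · simp only [coneVec_fst, Submodule.norm_coe, LinearIsometry.norm_map]
  · simp only [coneVec_snd, map_add, map_smul, extendIsometry_coe, extendIsometry_pole,
      Submodule.norm_coe, LinearIsometry.norm_map]

end ExtendIsometry

/-! ### Boosts: scalings of `K` -/

section Boost

variable {v : F}

/-- The **boost** `(t, x) ↦ (p t + q ⟪v,x⟫, x + (q t + (p − 1) ⟪v,x⟫) v)` of `ℝ × F` along the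
pole `v`; for `p² − q² = 1`, `p > 0` it is an orthochronous Lorentz transformation acting on
`K = (ℝ ∙ v)ᗮ` (in stereographic coordinates) as the scaling by `p + q`. [folklore] -/
def boostMap (v : F) (p q : ℝ) : (ℝ × F) →ₗ[ℝ] (ℝ × F) :=
  LinearMap.prod (p • LinearMap.fst ℝ ℝ F + q • ((innerₛₗ ℝ v).comp (LinearMap.snd ℝ ℝ F)))
    (LinearMap.snd ℝ ℝ F + (LinearMap.toSpanSingleton ℝ F v).comp
      (q • LinearMap.fst ℝ ℝ F + (p - 1) • ((innerₛₗ ℝ v).comp (LinearMap.snd ℝ ℝ F))))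

/-- The formula for `boostMap`. [folklore] -/
@[simp]
theorem boostMap_apply (v : F) (p q : ℝ) (u : ℝ × F) :
    boostMap v p q u = (p * u.1 + q * ⟪v, u.2⟫, u.2 + (q * u.1 + (p - 1) * ⟪v, u.2⟫) • v) := by
  simp [boostMap, LinearMap.toSpanSingleton_apply]

/-- Boosts preserve the Lorentz quadratic form (`‖v‖ = 1`, `p² − q² = 1`). [folklore] -/
theorem lorentzForm_boostMap (hv : ‖v‖ = 1) {p q : ℝ} (hpq : p ^ 2 - q ^ 2 = 1) (u : ℝ × F) :
    lorentzForm (boostMap v p q u) (boostMap v p q u) = lorentzForm u u := by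
  rw [lorentzForm_self, lorentzForm_self, boostMap_apply]
  dsimp only
  rw [norm_add_sq_real, real_inner_smul_right, real_inner_comm v u.2, norm_smul, hv,
    Real.norm_eq_abs, mul_one, sq_abs]
  linear_combination (⟪v, u.2⟫ ^ 2 - u.1 ^ 2) * hpq

/-- Boosts with `p > 0`, `p² − q² = 1` are orthochronous. [folklore] -/
theorem boostMap_fst_pos (hv : ‖v‖ = 1) {p q : ℝ} (hp : 0 < p) (hpq : p ^ 2 - q ^ 2 = 1) {y : F}
    (hy : ‖y‖ = 1) : 0 < (boostMap v p q ((1 : ℝ), y)).1 := by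
  rw [boostMap_apply]
  dsimp only
  rw [mul_one]
  set s := ⟪v, y⟫ with hs
  have hs1 : |s| ≤ 1 := by
    have := abs_real_inner_le_norm v y
    rwa [hv, hy, one_mul] at this
  have hs2 : s ^ 2 ≤ 1 := by
    have := (sq_le_one_iff_abs_le_one s).mpr hs1
    exact this
  have h1 : 1 ≤ (p + q * s) * (p - q * s) := by nlinarith [mul_nonneg (sq_nonneg q) (sub_nonneg.2 hs2)]
  by_contra hle
  rw [not_lt] at hle
  have h2 : 0 < p - q * s := by linarith
  nlinarith [mul_nonpos_of_nonpos_of_nonneg hle h2.le]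

variable [FiniteDimensional ℝ F]

/-- The boost as an element of the Lorentz group (`p > 0`, `p² − q² = 1`). [folklore] -/
def boostLorentz (hv : ‖v‖ = 1) (p q : ℝ) (hp : 0 < p) (hpq : p ^ 2 - q ^ 2 = 1) :
    lorentzGroup F :=
  lorentzGroup.ofLinearMap (boostMap v p q) (lorentzForm_boostMap hv hpq)
    (fun _ hy => boostMap_fst_pos hv hp hpq hy)

/-- **Scalings of `K` are Möbius transformations**: the boost acts as
`σ⁻¹(w) ↦ σ⁻¹((p + q) w)`. [folklore] -/
theorem boostLorentz_smul_stereoInvFun (hv : ‖v‖ = 1) {p q : ℝ} (hp : 0 < p)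
    (hpq : p ^ 2 - q ^ 2 = 1) (w : (ℝ ∙ v)ᗮ) :
    boostLorentz hv p q hp hpq • stereoInvFun hv w = stereoInvFun hv ((p + q) • w) := by
  refine moebius_stereoInvFun_eq hv (ν := p - q) ?_
  have hw : ⟪v, (w : F)⟫ = 0 := Submodule.mem_orthogonal_singleton_iff_inner_right.mp w.2
  have hpq' : (p - q) * (p + q) = 1 := by linear_combination hpq
  have hn : ‖(p + q) • (w : F)‖ ^ 2 = (p + q) ^ 2 * ‖(w : F)‖ ^ 2 := by
    rw [norm_smul, mul_pow, Real.norm_eq_abs, sq_abs]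
  change boostMap v p q (coneVec v (w : F)) = (p - q) • coneVec v (((p + q) • w : (ℝ ∙ v)ᗮ) : F)
  ext
  · simp only [boostMap_apply, coneVec_fst, coneVec_snd, Prod.smul_fst, smul_eq_mul,
      Submodule.coe_smul, hn, inner_add_right, inner_smul_right, hw, real_inner_self_eq_norm_sq,
      hv, mul_zero, one_pow, mul_one, zero_add]
    linear_combination (-(p + q) * ‖(w : F)‖ ^ 2) * hpq'
  · simp only [boostMap_apply, coneVec_fst, coneVec_snd, Prod.smul_snd, Submodule.coe_smul, hn,
      inner_add_right, inner_smul_right, hw, real_inner_self_eq_norm_sq, hv, smul_add,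
      smul_smul, mul_zero, one_pow, mul_one, zero_add]
    rw [add_assoc, ← add_smul]
    match_scalars
    · linear_combination (-4 : ℝ) * hpq'
    · linear_combination (-(p + q) * ‖(w : F)‖ ^ 2) * hpq'

/-- For every `c > 0` some element of the Lorentz group acts as the scaling `w ↦ c • w` of `K`.
[folklore] -/
theorem exists_smul_stereoInvFun_eq_scale (hv : ‖v‖ = 1) {c : ℝ} (hc : 0 < c) :
    ∃ A : lorentzGroup F, ∀ w : (ℝ ∙ v)ᗮ, A • stereoInvFun hv w = stereoInvFun hv (c • w) := by
  have hp : 0 < (c + c⁻¹) / 2 := by positivity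
  have hpq : ((c + c⁻¹) / 2) ^ 2 - ((c - c⁻¹) / 2) ^ 2 = 1 := by
    field_simp
    ring
  refine ⟨boostLorentz hv _ _ hp hpq, fun w => ?_⟩
  rw [boostLorentz_smul_stereoInvFun hv hp hpq w]
  congr 2
  ring

end Boost

/-! ### Parabolic transformations: translations of `K` -/

section Transl

variable {v : F}

/-- The linear functional `d(t, x) = t − ⟪v, x⟫`. [folklore] -/
def dFun (v : F) : (ℝ × F) →ₗ[ℝ] ℝ :=
  LinearMap.fst ℝ ℝ F - (innerₛₗ ℝ v).comp (LinearMap.snd ℝ ℝ F)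

/-- The linear functional `m(t, x) = ⟪β, x⟫ + (‖β‖²/2) (t − ⟪v, x⟫)`. [folklore] -/
def mFun (v β : F) : (ℝ × F) →ₗ[ℝ] ℝ :=
  (innerₛₗ ℝ β).comp (LinearMap.snd ℝ ℝ F) + (‖β‖ ^ 2 / 2) • dFun v

/-- The **parabolic Lorentz transformation** `(t, x) ↦ (t + m, x + d β + m v)`,
`d = t − ⟪v,x⟫`, `m = ⟪β,x⟫ + (‖β‖²/2) d`, which for `β ⊥ v` acts on `K = (ℝ ∙ v)ᗮ` (in
stereographic coordinates) as the translation by `2β`. [folklore] -/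
def translMap (v β : F) : (ℝ × F) →ₗ[ℝ] (ℝ × F) :=
  LinearMap.prod (LinearMap.fst ℝ ℝ F + mFun v β)
    (LinearMap.snd ℝ ℝ F + (LinearMap.toSpanSingleton ℝ F β).comp (dFun v) +
      (LinearMap.toSpanSingleton ℝ F v).comp (mFun v β))

/-- The formula for `translMap`. [folklore] -/
theorem translMap_apply (v β : F) (u : ℝ × F) :
    translMap v β u =
      (u.1 + (⟪β, u.2⟫ + ‖β‖ ^ 2 / 2 * (u.1 - ⟪v, u.2⟫)),
        u.2 + (u.1 - ⟪v, u.2⟫) • β + (⟪β, u.2⟫ + ‖β‖ ^ 2 / 2 * (u.1 - ⟪v, u.2⟫)) • v) := by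
  simp [translMap, mFun, dFun, LinearMap.toSpanSingleton_apply]

/-- Parabolic transformations preserve the Lorentz quadratic form (`‖v‖ = 1`, `β ⊥ v`).
[folklore] -/
theorem lorentzForm_translMap (hv : ‖v‖ = 1) {β : F} (hβ : ⟪v, β⟫ = 0) (u : ℝ × F) :
    lorentzForm (translMap v β u) (translMap v β u) = lorentzForm u u := by
  rw [lorentzForm_self, lorentzForm_self, translMap_apply]
  dsimp only
  simp only [norm_add_sq_real, inner_add_left, real_inner_smul_right, real_inner_smul_left,
    norm_smul, mul_pow, Real.norm_eq_abs, sq_abs, hv, mul_one]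
  rw [real_inner_comm β u.2, real_inner_comm v u.2, real_inner_comm v β, hβ]
  ring

/-- Parabolic transformations are orthochronous (`‖v‖ = 1`, `β ⊥ v`). [folklore] -/
theorem translMap_fst_pos (hv : ‖v‖ = 1) {β : F} (hβ : ⟪v, β⟫ = 0) {y : F} (hy : ‖y‖ = 1) :
    0 < (translMap v β ((1 : ℝ), y)).1 := by
  rw [translMap_apply]
  dsimp only
  set s := ⟪v, y⟫ with hs
  set e := ⟪β, y⟫ with he
  set B := ‖β‖ ^ 2 with hB
  have hs1 : s ≤ 1 := by
    have h1 := abs_real_inner_le_norm v y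
    rw [hv, hy, one_mul] at h1
    exact (abs_le.mp h1).2
  -- Cauchy–Schwarz for `⟪β, y − s v⟫ = e`
  have hcs : e ^ 2 ≤ B * (1 - s ^ 2) := by
    have h1 : ⟪β, y - s • v⟫ = e := by
      rw [inner_sub_right, real_inner_smul_right, real_inner_comm v β, hβ, mul_zero, sub_zero]
    have h2 : ‖y - s • v‖ ^ 2 = 1 - s ^ 2 := by
      rw [norm_sub_sq_real, real_inner_smul_right, real_inner_comm v y, ← hs, norm_smul, hv, hy,
        Real.norm_eq_abs, mul_one, sq_abs]
      ring
    have h3 := abs_real_inner_le_norm β (y - s • v)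
    rw [h1] at h3
    have h4 : |e| ^ 2 ≤ (‖β‖ * ‖y - s • v‖) ^ 2 := pow_le_pow_left₀ (abs_nonneg e) h3 2
    rw [sq_abs, mul_pow, h2] at h4
    exact h4
  have hB0 : 0 ≤ B := sq_nonneg _
  rcases eq_or_lt_of_le hs1 with hs' | hs'
  · -- `s = 1`: then `e = 0`
    have he0 : e = 0 := by
      rw [hs', one_pow, sub_self, mul_zero] at hcs
      exact pow_eq_zero_iff two_ne_zero |>.mp (le_antisymm hcs (sq_nonneg e))
    rw [he0, hs']
    norm_num
  · rcases eq_or_lt_of_le hB0 with hB' | hB'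
    · have he0 : e = 0 := by
        rw [← hB', zero_mul] at hcs
        exact pow_eq_zero_iff two_ne_zero |>.mp (le_antisymm hcs (sq_nonneg e))
      rw [he0, ← hB']
      norm_num
    · nlinarith [sq_nonneg (e + 2), mul_pos hB' (pow_pos (sub_pos.2 hs') 2)]

variable [FiniteDimensional ℝ F]

/-- The parabolic transformation as an element of the Lorentz group (`β ⊥ v`). [folklore] -/
def translLorentz (hv : ‖v‖ = 1) (β : F) (hβ : ⟪v, β⟫ = 0) : lorentzGroup F :=
  lorentzGroup.ofLinearMap (translMap v β) (lorentzForm_translMap hv hβ)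
    (fun _ hy => translMap_fst_pos hv hβ hy)

/-- **Translations of `K` are Möbius transformations**: `translLorentz hv β` acts as
`σ⁻¹(w) ↦ σ⁻¹(w + 2β)`. [folklore] -/
theorem translLorentz_smul_stereoInvFun (hv : ‖v‖ = 1) (β : (ℝ ∙ v)ᗮ) (w : (ℝ ∙ v)ᗮ) :
    translLorentz hv (β : F) (Submodule.mem_orthogonal_singleton_iff_inner_right.mp β.2) •
        stereoInvFun hv w = stereoInvFun hv (w + (2 : ℝ) • β) := by
  refine moebius_stereoInvFun_eq hv (ν := 1) ?_
  have hw : ⟪v, (w : F)⟫ = 0 := Submodule.mem_orthogonal_singleton_iff_inner_right.mp w.2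
  have hβ : ⟪v, (β : F)⟫ = 0 := Submodule.mem_orthogonal_singleton_iff_inner_right.mp β.2
  have hβ' : ⟪(β : F), v⟫ = 0 := by rw [real_inner_comm v (β : F)]; exact hβ
  have hn : ‖(w : F) + (2 : ℝ) • (β : F)‖ ^ 2 =
      ‖(w : F)‖ ^ 2 + 4 * ⟪(β : F), (w : F)⟫ + 4 * ‖(β : F)‖ ^ 2 := by
    rw [norm_add_sq_real, real_inner_smul_right, real_inner_comm (β : F) (w : F), norm_smul,
      Real.norm_eq_abs, mul_pow, sq_abs]
    ring
  change translMap v β (coneVec v (w : F)) = (1 : ℝ) • coneVec v (((w + (2 : ℝ) • β : (ℝ ∙ v)ᗮ)) : F)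
  rw [one_smul]
  ext
  · simp only [translMap_apply, coneVec_fst, coneVec_snd, Submodule.coe_add, Submodule.coe_smul,
      hn, inner_add_right, inner_smul_right, hw, hβ', real_inner_self_eq_norm_sq, hv,
      mul_zero, mul_one, one_pow, zero_add, add_zero]
    ring
  · simp only [translMap_apply, coneVec_fst, coneVec_snd, Submodule.coe_add, Submodule.coe_smul,
      hn, inner_add_right, inner_smul_right, hw, hβ', real_inner_self_eq_norm_sq, hv,
      smul_add, smul_smul, mul_zero, mul_one, one_pow, zero_add, add_zero]
    match_scalars <;> ring

/-- For every `b ∈ K` some element of the Lorentz group acts as the translation `w ↦ w + b`.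
[folklore] -/
theorem exists_smul_stereoInvFun_eq_add (hv : ‖v‖ = 1) (b : (ℝ ∙ v)ᗮ) :
    ∃ A : lorentzGroup F, ∀ w : (ℝ ∙ v)ᗮ, A • stereoInvFun hv w = stereoInvFun hv (w + b) := by
  refine ⟨translLorentz hv (((1 / 2 : ℝ) • b : (ℝ ∙ v)ᗮ) : F)
    (Submodule.mem_orthogonal_singleton_iff_inner_right.mp ((1 / 2 : ℝ) • b).2), fun w => ?_⟩
  rw [translLorentz_smul_stereoInvFun hv ((1 / 2 : ℝ) • b) w, smul_smul]
  norm_num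

end Transl

/-! ### Similarities and inversions of `K` are Möbius transformations -/

section Assembly

variable {v : F} [FiniteDimensional ℝ F]

/-- **Similarities of `K` are Möbius**: for `c > 0`, a linear isometry `A` of `K` and `b ∈ K`,
some element `γ` of the Lorentz group satisfies `γ • σ⁻¹(w) = σ⁻¹(c • A w + b)` for all
`w ∈ K`. [folklore] -/
theorem exists_smul_stereoInvFun_eq_similarity (hv : ‖v‖ = 1) {c : ℝ} (hc : 0 < c)
    (A : (ℝ ∙ v)ᗮ →ₗᵢ[ℝ] (ℝ ∙ v)ᗮ) (b : (ℝ ∙ v)ᗮ) :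
    ∃ γ : lorentzGroup F, ∀ w : (ℝ ∙ v)ᗮ,
      γ • stereoInvFun hv w = stereoInvFun hv (c • A w + b) := by
  obtain ⟨S, hS⟩ := exists_smul_stereoInvFun_eq_scale (F := F) hv hc
  obtain ⟨T, hT⟩ := exists_smul_stereoInvFun_eq_add (F := F) hv b
  refine ⟨T * S * isometryLorentz (extendIsometry hv A), fun w => ?_⟩
  rw [mul_smul, mul_smul, extendIsometry_smul_stereoInvFun, hS, hT]

/-- **Inversions of `K` are Möbius**: for `x₀ ∈ K` and `r > 0`, some element `γ` of the Lorentz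
group satisfies `γ • σ⁻¹(w) = σ⁻¹(ι(w))` for all `w ≠ x₀`, where
`ι = EuclideanGeometry.inversion x₀ r` is the inversion in the sphere of centre `x₀` and radius
`r` (`ι(w) = x₀ + (r/‖w − x₀‖)² (w − x₀)`). [folklore] -/
theorem exists_smul_stereoInvFun_eq_inversion (hv : ‖v‖ = 1) (x₀ : (ℝ ∙ v)ᗮ) {r : ℝ}
    (hr : 0 < r) :
    ∃ γ : lorentzGroup F, ∀ w : (ℝ ∙ v)ᗮ, w ≠ x₀ →
      γ • stereoInvFun hv w = stereoInvFun hv (EuclideanGeometry.inversion x₀ r w) := by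
  obtain ⟨T₁, hT₁⟩ := exists_smul_stereoInvFun_eq_add (F := F) hv (-x₀)
  obtain ⟨S, hS⟩ := exists_smul_stereoInvFun_eq_scale (F := F) hv (c := r ^ 2 / 4) (by positivity)
  obtain ⟨T₂, hT₂⟩ := exists_smul_stereoInvFun_eq_add (F := F) hv x₀
  refine ⟨T₂ * S * isometryLorentz ((ℝ ∙ v)ᗮ.reflection.toLinearIsometry) * T₁,
    fun w hw => ?_⟩
  have hw' : w + -x₀ ≠ 0 := fun h => hw (by rwa [← sub_eq_add_neg, sub_eq_zero] at h)
  rw [mul_smul, mul_smul, mul_smul, hT₁, reflection_smul_stereoInvFun hv _ hw', hS, hT₂]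
  congr 1
  rw [EuclideanGeometry.inversion, vsub_eq_sub, vadd_eq_add, dist_eq_norm, smul_smul,
    ← sub_eq_add_neg, Submodule.coe_norm, div_pow]
  congr 1
  have hn : ‖w - x₀‖ ≠ 0 := norm_ne_zero_iff.mpr (sub_ne_zero.mpr hw)
  field_simp

variable (F) in
omit [FiniteDimensional ℝ F] in
/-- The action maps of elements of the Lorentz group are Möbius self-maps of the sphere.
[folklore] -/
theorem smul_mem_moebiusMaps (γ : lorentzGroup F) :
    (fun y : sphere (0 : F) 1 => γ • y) ∈ moebiusMaps F :=
  ⟨γ, rfl⟩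

end Assembly

/-! ### Transport to Mathlib's charts `stereographic' n V` of the sphere -/

section Euclidean

variable {n : ℕ} [Fact (finrank ℝ F = n + 1)]

variable (n) in
/-- The linear isometry `(ℝ ∙ V)ᗮ ≃ₗᵢ ℝⁿ` used by Mathlib's chart `stereographic' n V`.
[folklore] -/
def stereoIsometry (V : sphere (0 : F) 1) :
    (ℝ ∙ (V : F))ᗮ ≃ₗᵢ[ℝ] EuclideanSpace ℝ (Fin n) :=
  (OrthonormalBasis.fromOrthogonalSpanSingleton n (ne_zero_of_mem_unit_sphere V)).repr

/-- Mathlib's chart inverse `(stereographic' n V).symm` is `σ⁻¹ ∘ U⁻¹` with `σ⁻¹ = stereoInvFun`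
(pole `V`) and `U = stereoIsometry n V`. [folklore] -/
theorem stereographic'_symm_apply_eq (V : sphere (0 : F) 1) (x : EuclideanSpace ℝ (Fin n)) :
    (stereographic' n V).symm x =
      stereoInvFun (norm_eq_of_mem_sphere V) ((stereoIsometry n V).symm x) :=
  rfl

/-- Linear isometries commute with inversions in spheres. [folklore] -/
theorem map_inversion {E E' : Type*} [NormedAddCommGroup E] [InnerProductSpace ℝ E]
    [NormedAddCommGroup E'] [InnerProductSpace ℝ E'] (e : E ≃ₗᵢ[ℝ] E') (x₀ : E) (r : ℝ)
    (x : E) :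
    e (EuclideanGeometry.inversion x₀ r x) = EuclideanGeometry.inversion (e x₀) r (e x) := by
  simp only [EuclideanGeometry.inversion, vsub_eq_sub, vadd_eq_add, map_add, map_smul,
    map_sub, LinearIsometryEquiv.dist_map]

/-- **Similarities of `ℝⁿ` are Möbius transformations of `Sⁿ`** (in Mathlib's chart
`stereographic' n V`): for `c > 0`, a linear isometry `A` and `b`, there is a Möbius self-map
`γ ∈ moebiusMaps F` of the sphere with `(stereographic' n V).symm (c • A x + b) =
γ ((stereographic' n V).symm x)` for all `x`. [folklore] -/
theorem exists_moebiusMaps_similarity (V : sphere (0 : F) 1) {c : ℝ} (hc : 0 < c)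
    (A : EuclideanSpace ℝ (Fin n) →ₗᵢ[ℝ] EuclideanSpace ℝ (Fin n)) (b : EuclideanSpace ℝ (Fin n)) :
    ∃ γ ∈ moebiusMaps F, ∀ x : EuclideanSpace ℝ (Fin n),
      (stereographic' n V).symm (c • A x + b) = γ ((stereographic' n V).symm x) := by
  haveI : FiniteDimensional ℝ F := .of_fact_finrank_eq_succ n
  set U := stereoIsometry n V with hU
  obtain ⟨γ, hγ⟩ := exists_smul_stereoInvFun_eq_similarity (F := F) (norm_eq_of_mem_sphere V) hc
    (U.symm.toLinearIsometry.comp (A.comp U.toLinearIsometry)) (U.symm b)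
  refine ⟨fun y => γ • y, smul_mem_moebiusMaps F γ, fun x => ?_⟩
  change _ = γ • (stereographic' n V).symm x
  rw [stereographic'_symm_apply_eq, stereographic'_symm_apply_eq, ← hU, hγ]
  congr 1
  simp

/-- **Inversions of `ℝⁿ` are Möbius transformations of `Sⁿ`** (in Mathlib's chart
`stereographic' n V`): for `x₀` and `r > 0` there is `γ ∈ moebiusMaps F` with
`(stereographic' n V).symm (inversion x₀ r x) = γ ((stereographic' n V).symm x)` for all
`x ≠ x₀`. [folklore] -/
theorem exists_moebiusMaps_inversion (V : sphere (0 : F) 1) (x₀ : EuclideanSpace ℝ (Fin n))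
    {r : ℝ} (hr : 0 < r) :
    ∃ γ ∈ moebiusMaps F, ∀ x : EuclideanSpace ℝ (Fin n), x ≠ x₀ →
      (stereographic' n V).symm (EuclideanGeometry.inversion x₀ r x) =
        γ ((stereographic' n V).symm x) := by
  haveI : FiniteDimensional ℝ F := .of_fact_finrank_eq_succ n
  set U := stereoIsometry n V with hU
  obtain ⟨γ, hγ⟩ :=
    exists_smul_stereoInvFun_eq_inversion (F := F) (norm_eq_of_mem_sphere V) (U.symm x₀) hr
  refine ⟨fun y => γ • y, smul_mem_moebiusMaps F γ, fun x hx => ?_⟩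
  have hx' : U.symm x ≠ U.symm x₀ := fun h => hx (U.symm.injective h)
  change _ = γ • (stereographic' n V).symm x
  rw [stereographic'_symm_apply_eq, stereographic'_symm_apply_eq, ← hU, hγ _ hx',
    map_inversion]

end Euclidean

end Literature.Geometry.Conformal

end
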